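import Literature.NumberTheory.EllipticCurves.SelmerPInftyIsogeny
import Literature.NumberTheory.EllipticCurves.IwasawaSelmerDualProofs
import Literature.NumberTheory.EllipticCurves.BSDInvariantsProofs
import HarnessLib

/-!
# `Sel_{p^∞}(E/L) → Sel_{p^∞}(E'/L)` along a `K`-isogeny, over any `L = K̄^H` (in particular over a
# `ℤ_p`-extension `K_∞`), with `Sel(φ̂) ∘ Sel(φ) = deg φ`; and the INVARIANCE of the Iwasawa module
# `X(E/K_∞) = Sel_{p^∞}(E/K_∞)^∨` (`WeierstrassCurve.SelmerDualData`) under a `K`-isomorphism of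
# Weierstrass models (`C • W`)

Topic `NumberTheory/EllipticCurves` (cell `pub/bsd-littype`, seat `bsd-littype-04` gen 6; OPEN-QUESTIONS-04
Q24 (c)). HONEST FRAMING: typed ≠ proved ≠ endorsed; nothing here is a named fact — definitions with
bodies and theorems only (D-0014/D-0026), all standard functoriality (Serre I.§2.4, Milne I.§6, Silverman X.§4,
Greenberg LNM 1716 §1).

PROVENANCE. §2–§4 below are RE-HOMED, with the `p`-primary torsion map replaced by the tree's
`Literature.NumberTheory.EllipticCurves.primaryTorsionMap` (`SelmerPInftyIsogeny.lean`), from the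
summit-side file `Summits/BirchSwinnertonDyer/Rank1Residual/X2/IsogenySelmerInfty.lean` (cell
`b2b-bsdres`, unit `b2b-bsdres-eisenstein-p2`, gen 18: `Summit.BirchSwinnertonDyer.Rank1Residual.X2.
IsogenySelmerInfty.{h1Map, selmerMap, isogenySelmerInftyMap, …}`), which a `Literature/` file cannot
import; a promotion request for those declarations is filed — when it lands, §2–§4 here can be replaced
by that import. §5–§6 (the change-of-variables equivalence and the transport of `SelmerDualData`) are new.

WHY (Literature consumer). The cyclotomic main-conjecture facts of the tree
(`YanZhu2026.thm49_charIdeal_eq_padicLFunction_integral`, `kato_divisibility`, `Wuthrich2014.…`,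
`CastellaGrossiSkinner2025.thmA_…`) are stated for a GLOBALLY MINIMAL model `W`, on data
`D : W.SelmerDualData κ γ`; descent statements for a quadratic twist (e.g.
`YanZhu2026.lemma53_charIdeal_mul_charIdeal_le_toPlus_charIdeal`, `padicLFunctionEK`) speak of the
model `W.quadraticTwist d`, which is not minimal. Moving a characteristic ideal from one model to the
other needs: `Sel_{p^∞}(E/K_∞)` and its `Λ`-module dual do not depend on the Weierstrass model —
Silverman, *AEC*, X.§4 (the Selmer group is attached to `E/K`); Greenberg, LNM 1716, §1–2. This file
proves it in the tree's vocabulary: for `C : VariableChange K`, an additive equivalence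
`Sel_{p^∞}(W/K_∞) ≃+ Sel_{p^∞}(C • W/K_∞)` commuting with the conjugation action of `Γ_K` (§5), and for
every datum `D` on `C • W` a datum on `W` with THE SAME underlying `Λ`-module (§6), hence the same
characteristic ideal, torsion-ness, `μ` and `λ` — in the `∃`-form along an equation `C • W₁ = W₂`
(`exists_selmerDualData_of_smul_eq`), which is how the tree spells "`W₂` is a model of `W₁`"
(`∃ C, C • W' = W.quadraticTwist d`).

## Contents

* §2 `h1Map p H f hf : H¹(H, E[p^∞]) → H¹(H, E'[p^∞])` for a subgroup `H ≤ Γ_K` and a `Γ_K`-equivariant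
  `f : E(K̄) → E'(K̄)` (the tree's `resH1Hom` for the pair `(id_H, f|E[p^∞])`): on cocycles,
  functoriality, `H¹(H,g) ∘ H¹(H,f) = n` when `g ∘ f = [n]`, compatibility with `conjH1`.
* §3 `h1Map` respects the local kernels (given local points maps, `HasLocalPointsMaps`) hence maps
  `Sel_{p^∞}(E/L)` into `Sel_{p^∞}(E'/L)`: `selmerMap`, `Sel(g) ∘ Sel(f) = n`, `conjH1`-compatibility.
* §4 `isogenySelmerInftyMap p κ φ : Sel_{p^∞}(E/K_∞) → Sel_{p^∞}(E'/K_∞)` for a `K`-isogeny over a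
  number field (local points maps by `Isogeny.hasLocalPointsMaps_holds`), composites `= deg`.
* §5 `selmerInftyEquivOfSmul W p C κ : Sel_{p^∞}(W/K_∞) ≃+ Sel_{p^∞}(C • W/K_∞)` (the substitution
  isomorphism `geomPointsEquiv` of `BSDInvariantsProofs` and its inverse both have local points maps:
  `localPointsEquiv`, `pointsMap_geomPointsEquiv`), and its `conjH1`-compatibility.
* §6 `selmerDualDataOfSmul W p C D : W.SelmerDualData κ γ` for `D : (C • W).SelmerDualData κ γ`, with
  `X` unchanged (characters precomposed with §5, `dualComap`); `charIdeal`/`IsTorsion`/`mu`/`lambda`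
  unchanged (`rfl`); `exists_selmerDualData_of_smul_eq` (the `∃`-form along `C • W₁ = W₂`).

## References
* J. H. Silverman, *The Arithmetic of Elliptic Curves*, 2nd ed., GTM 106 (2009), III.3.1(b), III.4,
  III.6.1, X.§4. [SilvermanAEC2009]
* R. Greenberg, *Iwasawa theory for elliptic curves*, LNM 1716 (1999), §1–2. [GreenbergLNM1716]
* J.-P. Serre, *Galois Cohomology* (1997), I.§2.4–2.5. J. S. Milne, *Arithmetic Duality Theorems*, I.§6–7.
* R. Greenberg, V. Vatsal, Invent. Math. 142 (2000), §2 p. 28 (isogeny invariance of `λ`). [GreenbergVatsal2000]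
-/

set_option autoImplicit false

noncomputable section

open scoped Classical

universe u

open WeierstrassCurve Literature.NumberTheory.GaloisRepresentations Field IsDedekindDomain NumberField

namespace Literature.NumberTheory.EllipticCurves.IsogenySelmerInfty

variable {K : Type u} [Field K] {W W' W'' : WeierstrassCurve K} (p : ℕ)

/-! ## §2. The induced map on `H¹(H, E[p^∞])` for a subgroup `H ≤ Γ_K` -/

section H1

variable (H : Subgroup (absoluteGaloisGroup K))

/-- The compatibility of the pair `(id_H, f|E[p^∞])` (`H` acting through `H ≤ Γ_K`). [cite: SerreGaloisCohomology1997, I.§2.4 (functoriality of H¹ for compatible pairs)] -/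
theorem primaryTorsionMap_smul_subgroup (f : W.geomPoints →+ W'.geomPoints)
    (hf : ∀ (σ : absoluteGaloisGroup K) (P : W.geomPoints), f (σ • P) = σ • f P)
    (x : H) (m : geomPrimaryTorsion W p) :
    primaryTorsionMap p f (ContinuousMonoidHom.id H x • m) = x • primaryTorsionMap p f m := by
  rw [Subgroup.smul_def, Subgroup.smul_def]
  exact primaryTorsionMap_smul p f hf x m

/-- **`H¹(H, f) : H¹(H, E[p^∞]) → H¹(H, E'[p^∞])`** for a subgroup `H ≤ Γ_K` (`H = Gal(K̄/L)`)
and a `Γ_K`-equivariant `f : E(K̄) → E'(K̄)`: the tree's `resH1Hom` for the compatible pair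
`(id_H, f|E[p^∞])`. Serre, *Galois Cohomology*, I.§2.4. [cite: SerreGaloisCohomology1997, I.§2.4 (functoriality of H¹ for compatible pairs)] -/
def h1Map (f : W.geomPoints →+ W'.geomPoints)
    (hf : ∀ (σ : absoluteGaloisGroup K) (P : W.geomPoints), f (σ • P) = σ • f P) :
    W.subgroupH1 p H →+ W'.subgroupH1 p H :=
  resH1Hom (ContinuousMonoidHom.id H) (primaryTorsionMap p f) (primaryTorsionMap_smul_subgroup p H f hf)

/-- `H¹(H, f)` on explicit cocycles: `[a] ↦ [f ∘ a]`. [cite: SerreGaloisCohomology1997, I.§2.4 (functoriality of H¹ for compatible pairs)] -/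
theorem h1Map_oneCocycleClass (f : W.geomPoints →+ W'.geomPoints)
    (hf : ∀ (σ : absoluteGaloisGroup K) (P : W.geomPoints), f (σ • P) = σ • f P)
    (a : contOneCocycles (discreteTopRep H (geomPrimaryTorsion W p))) :
    h1Map p H f hf (oneCocycleClass _ a) =
      oneCocycleClass _ (contOneCocycles.push (primaryTorsionMap p f)
        (primaryTorsionMap_smul_subgroup p H f hf) a) :=
  resH1Hom_id_oneCocycleClass _ _ a

/-- **Functoriality**: `H¹(H, g) ∘ H¹(H, f) = H¹(H, g ∘ f)`. [cite: SerreGaloisCohomology1997, I.§2.4 (functoriality of H¹ for compatible pairs)] -/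
theorem h1Map_h1Map (f : W.geomPoints →+ W'.geomPoints)
    (hf : ∀ (σ : absoluteGaloisGroup K) (P : W.geomPoints), f (σ • P) = σ • f P)
    (g : W'.geomPoints →+ W''.geomPoints)
    (hg : ∀ (σ : absoluteGaloisGroup K) (Q : W'.geomPoints), g (σ • Q) = σ • g Q)
    (c : W.subgroupH1 p H) :
    h1Map p H g hg (h1Map p H f hf c) =
      h1Map p H (g.comp f) (fun σ P ↦ by simp [hf, hg]) c := by
  change ((h1Map p H g hg).comp (h1Map p H f hf)) c = _
  unfold h1Map
  rw [resH1Hom_comp]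
  exact congrArg (fun F : W.subgroupH1 p H →+ W''.subgroupH1 p H ↦ F c)
    (resH1Hom_congr (by ext; rfl) (primaryTorsionMap_comp p f g).symm _ _)

/-- **`g ∘ f = [n]` ⟹ `H¹(H, g) ∘ H¹(H, f) = n`** on `H¹(H, E[p^∞])`. [cite: SerreGaloisCohomology1997, I.§2.4 (functoriality of H¹ for compatible pairs)] -/
theorem h1Map_h1Map_of_comp_eq_nsmul (f : W.geomPoints →+ W'.geomPoints)
    (hf : ∀ (σ : absoluteGaloisGroup K) (P : W.geomPoints), f (σ • P) = σ • f P)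
    (g : W'.geomPoints →+ W.geomPoints)
    (hg : ∀ (σ : absoluteGaloisGroup K) (Q : W'.geomPoints), g (σ • Q) = σ • g Q)
    {n : ℕ} (h : ∀ P : W.geomPoints, g (f P) = (n : ℤ) • P) (c : W.subgroupH1 p H) :
    h1Map p H g hg (h1Map p H f hf c) = n • c := by
  obtain ⟨a, rfl⟩ := oneCocycleClass_surjective _ c
  rw [h1Map_oneCocycleClass, h1Map_oneCocycleClass]
  have hs := oneCocycleClass_smul (discreteTopRep H (geomPrimaryTorsion W p)) (n : ℤ) a
  conv at hs => rhs; rw [Nat.cast_smul_eq_nsmul]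
  rw [← hs]
  congr 1
  apply Subtype.ext
  ext σ
  change g (f ((a.1 σ : geomPrimaryTorsion W p) : W.geomPoints)) =
    (((n : ℤ) • a.1 σ : geomPrimaryTorsion W p) : W.geomPoints)
  rw [h, AddSubgroupClass.coe_zsmul]

/-- **`H¹(H, f)` commutes with the conjugation action** of `σ ∈ Γ_K` (for `H` normal): both
composites are induced by the compatible pair `(h ↦ σ⁻¹hσ, m ↦ σ • f m = f (σ • m))`. [cite: SerreGaloisCohomology1997, I.§2.4 (functoriality of H¹ for compatible pairs)] -/
theorem h1Map_conjH1 [H.Normal] (f : W.geomPoints →+ W'.geomPoints)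
    (hf : ∀ (σ : absoluteGaloisGroup K) (P : W.geomPoints), f (σ • P) = σ • f P)
    (σ : absoluteGaloisGroup K) (c : W.subgroupH1 p H) :
    h1Map p H f hf (W.conjH1 p H σ c) = W'.conjH1 p H σ (h1Map p H f hf c) := by
  change ((h1Map p H f hf).comp (W.conjH1 p H σ)) c = ((W'.conjH1 p H σ).comp (h1Map p H f hf)) c
  unfold h1Map WeierstrassCurve.conjH1 Literature.NumberTheory.EllipticCurves.conjH1
  rw [resH1Hom_comp, resH1Hom_comp]
  refine congrArg (fun F : W.subgroupH1 p H →+ W'.subgroupH1 p H ↦ F c) (resH1Hom_congr ?_ ?_ _ _)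
  · ext; rfl
  · ext m
    simp only [AddMonoidHom.coe_comp, Function.comp_apply, DistribSMul.toAddMonoidHom_apply]
    exact congrArg Subtype.val (primaryTorsionMap_smul p f hf σ m)

end H1

/-! ## §3. The local conditions: `H¹(H, f)` maps `Sel_{p^∞}(E/L)` into `Sel_{p^∞}(E'/L)` -/

section Selmer

variable (H : Subgroup (absoluteGaloisGroup K)) {E : Type u} [Field E] [Algebra K E]

/-- **`H¹(H, f)` respects the local kernels** at the chosen place: if `f` extends to a
`Γ_E`-equivariant `f_E : E(K̄_E) → E'(K̄_E)` compatible with `K̄ → K̄_E`, then `H¹(H, f)` maps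
`ker(H¹(H, E[p^∞]) → H¹(H_E, E(K̄_E)))` into the corresponding kernel for `E'`.
Serre, *Galois Cohomology*, I.§2.4. [cite: SerreGaloisCohomology1997, I.§2.4 (functoriality of H¹ for compatible pairs)] -/
theorem h1Map_mem_localKerOver (f : W.geomPoints →+ W'.geomPoints)
    (hf : ∀ (σ : absoluteGaloisGroup K) (P : W.geomPoints), f (σ • P) = σ • f P)
    (fE : localPoints W E →+ localPoints W' E)
    (hfE : ∀ (τ : absoluteGaloisGroup E) (P : localPoints W E), fE (τ • P) = τ • fE P)
    (hcomp : ∀ P : W.geomPoints, fE (pointsMap W E P) = pointsMap W' E (f P))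
    {c : W.subgroupH1 p H} (hc : c ∈ W.localKerOver p H E) :
    h1Map p H f hf c ∈ W'.localKerOver p H E := by
  rw [WeierstrassCurve.mem_localKerOver_iff] at hc ⊢
  have hfE' : ∀ (τ : localSubgroup H E) (P : localPoints W E),
      fE (ContinuousMonoidHom.id (localSubgroup H E) τ • P) = τ • fE P := fun τ P ↦ by
    rw [Subgroup.smul_def, Subgroup.smul_def]
    exact hfE τ P
  have key : (W'.localResOver p H E).comp (h1Map p H f hf) =
      (resH1Hom (ContinuousMonoidHom.id (localSubgroup H E)) fE hfE').comp (W.localResOver p H E) := by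
    unfold h1Map WeierstrassCurve.localResOver WeierstrassCurve.localResOverOfEmb
    erw [resH1Hom_comp, resH1Hom_comp]
    refine resH1Hom_congr (by ext; rfl) ?_ _ _
    ext m
    exact (hcomp (m : W.geomPoints)).symm
  have hkey := congrArg (fun F : W.subgroupH1 p H →+ _ ↦ F c) key
  simp only [AddMonoidHom.comp_apply] at hkey
  rw [hkey, hc, map_zero]

variable [NumberField K] [H.Normal]

/-- **`H¹(H, f)` maps `Sel_{p^∞}(E/L)` into `Sel_{p^∞}(E'/L)`** (`L = K̄^H`) when `f` has local points
maps (e.g. any `K`-isogeny, `Isogeny.hasLocalPointsMaps_holds`, or the substitution of a change of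
variables, §5): the local condition at every place of `K` and every conjugate (= every place of `L`)
is respected (`h1Map_mem_localKerOver`, `h1Map_conjH1`). Milne, *ADT*, I.§6–7; Greenberg LNM 1716 §2.
[cite: MilneADT2006, I.§6 (Selmer groups; functoriality)] -/
theorem h1Map_mem_selmerGroupOver (f : W.geomPoints →+ W'.geomPoints)
    (hf : ∀ (σ : absoluteGaloisGroup K) (P : W.geomPoints), f (σ • P) = σ • f P)
    (hloc : HasLocalPointsMaps W W' f) {c : W.subgroupH1 p H} (hc : c ∈ W.selmerGroupOver p H) :
    h1Map p H f hf c ∈ W'.selmerGroupOver p H := by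
  rw [WeierstrassCurve.mem_selmerGroupOver_iff] at hc ⊢
  refine ⟨fun v σ ↦ ?_, fun w σ ↦ ?_⟩
  · obtain ⟨fE, hfE, hcomp⟩ := hloc (v.adicCompletion K)
    rw [← h1Map_conjH1]
    exact h1Map_mem_localKerOver p H f hf fE hfE hcomp (hc.1 v σ)
  · obtain ⟨fE, hfE, hcomp⟩ := hloc w.Completion
    rw [← h1Map_conjH1]
    exact h1Map_mem_localKerOver p H f hf fE hfE hcomp (hc.2 w σ)

/-- **`Sel(f) : Sel_{p^∞}(E/L) → Sel_{p^∞}(E'/L)`**, the restriction of `H¹(H, f)`. [cite: MilneADT2006, I.§6 (Selmer groups; functoriality)] -/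
def selmerMap (f : W.geomPoints →+ W'.geomPoints)
    (hf : ∀ (σ : absoluteGaloisGroup K) (P : W.geomPoints), f (σ • P) = σ • f P)
    (hloc : HasLocalPointsMaps W W' f) : W.selmerGroupOver p H →+ W'.selmerGroupOver p H :=
  ((h1Map p H f hf).comp (W.selmerGroupOver p H).subtype).codRestrict _ fun c ↦
    h1Map_mem_selmerGroupOver p H f hf hloc c.2

/-- Unfolding `selmerMap` on the underlying classes. [cite: MilneADT2006, I.§6 (Selmer groups; functoriality)] -/
@[simp]
theorem coe_selmerMap_apply (f : W.geomPoints →+ W'.geomPoints)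
    (hf : ∀ (σ : absoluteGaloisGroup K) (P : W.geomPoints), f (σ • P) = σ • f P)
    (hloc : HasLocalPointsMaps W W' f) (c : W.selmerGroupOver p H) :
    (selmerMap p H f hf hloc c : W'.subgroupH1 p H) = h1Map p H f hf c :=
  rfl

/-- **`Sel(g) ∘ Sel(f) = n`** when `g ∘ f = [n]`. [cite: MilneADT2006, I.§6 (Selmer groups; functoriality)] -/
theorem selmerMap_selmerMap_of_comp_eq_nsmul (f : W.geomPoints →+ W'.geomPoints)
    (hf : ∀ (σ : absoluteGaloisGroup K) (P : W.geomPoints), f (σ • P) = σ • f P)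
    (hloc : HasLocalPointsMaps W W' f) (g : W'.geomPoints →+ W.geomPoints)
    (hg : ∀ (σ : absoluteGaloisGroup K) (Q : W'.geomPoints), g (σ • Q) = σ • g Q)
    (hloc' : HasLocalPointsMaps W' W g)
    {n : ℕ} (h : ∀ P : W.geomPoints, g (f P) = (n : ℤ) • P) (c : W.selmerGroupOver p H) :
    selmerMap p H g hg hloc' (selmerMap p H f hf hloc c) = n • c := by
  apply Subtype.ext
  rw [coe_selmerMap_apply, coe_selmerMap_apply, AddSubmonoidClass.coe_nsmul]
  exact h1Map_h1Map_of_comp_eq_nsmul p H f hf g hg h c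

/-- `Sel(f)` commutes with the conjugation action of `Γ_K` on the Selmer groups. [cite: MilneADT2006, I.§6 (Selmer groups; functoriality)] -/
theorem coe_selmerMap_conjH1 (f : W.geomPoints →+ W'.geomPoints)
    (hf : ∀ (σ : absoluteGaloisGroup K) (P : W.geomPoints), f (σ • P) = σ • f P)
    (hloc : HasLocalPointsMaps W W' f) (σ : absoluteGaloisGroup K) (c : W.selmerGroupOver p H)
    (hσc : W.conjH1 p H σ c ∈ W.selmerGroupOver p H) :
    (selmerMap p H f hf hloc ⟨W.conjH1 p H σ c, hσc⟩ : W'.subgroupH1 p H) =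
      W'.conjH1 p H σ (selmerMap p H f hf hloc c) := by
  rw [coe_selmerMap_apply, coe_selmerMap_apply]
  exact h1Map_conjH1 p H f hf σ c

end Selmer

/-! ## §4. Isogenies over a number field: `Sel_{p^∞}(E/K_∞) ⇄ Sel_{p^∞}(E'/K_∞)` with
composites `deg` -/

section Isogeny

variable [NumberField K] [Fact p.Prime] (κ : ZpExtension K p)

/-- **`Sel(φ) : Sel_{p^∞}(E/K_∞) → Sel_{p^∞}(E'/K_∞)` for a `K`-isogeny `φ : E → E'`** (local points
maps by `Isogeny.hasLocalPointsMaps_holds`). Greenberg LNM 1716 §1; GV 2000 p. 28 ("a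
`p`-isogeny"). [cite: MilneADT2006, I.§6 (Selmer groups; functoriality)] -/
def isogenySelmerInftyMap (φ : Isogeny W W') : W.selmerInfty κ →+ W'.selmerInfty κ :=
  haveI : PerfectField K := PerfectField.ofCharZero
  selmerMap p κ.kerSubgroup φ.toAddMonoidHom φ.equivariant
    (Isogeny.hasLocalPointsMaps_holds W W' φ)

/-- Unfolding: `Sel(φ)` is `H¹(Gal(K̄/K_∞), φ)` on classes. [cite: MilneADT2006, I.§6 (Selmer groups; functoriality)] -/
theorem coe_isogenySelmerInftyMap_apply (φ : Isogeny W W') (c : W.selmerInfty κ) :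
    (isogenySelmerInftyMap p κ φ c : W'.subgroupH1 p κ.kerSubgroup) =
      h1Map p κ.kerSubgroup φ.toAddMonoidHom φ.equivariant c :=
  rfl

/-- **`Sel(ψ) ∘ Sel(φ) = deg φ`** on `Sel_{p^∞}(E/K_∞)` for an isogeny `φ` and any `ψ : E' → E` with
`ψ ∘ φ = [deg φ]` (the dual isogeny, Silverman III.6.1(a), tree `Isogeny.exists_dual_of_isElliptic`).
[cite: SilvermanAEC2009, Thm. III.6.1(a)] -/
theorem isogenySelmerInftyMap_comp_apply (φ : Isogeny W W') (ψ : Isogeny W' W) {n : ℕ}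
    (h : ∀ P : W.geomPoints, ψ (φ P) = (n : ℤ) • P) (c : W.selmerInfty κ) :
    isogenySelmerInftyMap p κ ψ (isogenySelmerInftyMap p κ φ c) = n • c :=
  haveI : PerfectField K := PerfectField.ofCharZero
  selmerMap_selmerMap_of_comp_eq_nsmul p κ.kerSubgroup φ.toAddMonoidHom φ.equivariant
    (Isogeny.hasLocalPointsMaps_holds W W' φ) ψ.toAddMonoidHom ψ.equivariant
    (Isogeny.hasLocalPointsMaps_holds W' W ψ) (fun P ↦ h P) c

/-- `Sel(φ)` commutes with `conj_γ`. [cite: MilneADT2006, I.§6 (Selmer groups; functoriality)] -/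
theorem coe_isogenySelmerInftyMap_conjH1 (φ : Isogeny W W') (γ : absoluteGaloisGroup K)
    (c : W.selmerInfty κ) (hγc : W.conjH1 p κ.kerSubgroup γ c ∈ W.selmerInfty κ) :
    (isogenySelmerInftyMap p κ φ ⟨W.conjH1 p κ.kerSubgroup γ c, hγc⟩ : W'.subgroupH1 p κ.kerSubgroup) =
      W'.conjH1 p κ.kerSubgroup γ (isogenySelmerInftyMap p κ φ c) :=
  haveI : PerfectField K := PerfectField.ofCharZero
  coe_selmerMap_conjH1 p κ.kerSubgroup φ.toAddMonoidHom φ.equivariant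
    (Isogeny.hasLocalPointsMaps_holds W W' φ) γ c hγc

end Isogeny

/-! ## §5. A change of variables: `Sel_{p^∞}(W/K_∞) ≃+ Sel_{p^∞}(C • W/K_∞)` -/

section VariableChange

variable (W) (C : VariableChange K)

/-- The substitution isomorphism `E(K̄) ≃+ (C • E)(K̄)` has local points maps (the local substitution
isomorphisms `localPointsEquiv`, compatible by `pointsMap_geomPointsEquiv`). Silverman, *AEC*, X.§4.
[cite: SilvermanAEC2009, X.§4 (Selmer group attached to E/K)] -/
theorem hasLocalPointsMaps_geomPointsEquiv :
    HasLocalPointsMaps W (C • W) (geomPointsEquiv W C).toAddMonoidHom :=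
  fun E _ _ ↦ ⟨(localPointsEquiv W C E).toAddMonoidHom, localPointsEquiv_smul W C E,
    fun P ↦ (pointsMap_geomPointsEquiv W C E P).symm⟩

/-- The inverse substitution `(C • E)(K̄) ≃+ E(K̄)` is `Γ_K`-equivariant. [cite: SilvermanAEC2009, X.§4 (Selmer group attached to E/K)] -/
theorem geomPointsEquiv_symm_smul (σ : absoluteGaloisGroup K) (Q : (C • W).geomPoints) :
    (geomPointsEquiv W C).symm (σ • Q) = σ • (geomPointsEquiv W C).symm Q := by
  apply (geomPointsEquiv W C).injective
  rw [AddEquiv.apply_symm_apply, geomPointsEquiv_smul, AddEquiv.apply_symm_apply]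

/-- The inverse substitution has local points maps (the inverse local substitutions). [cite: SilvermanAEC2009, X.§4 (Selmer group attached to E/K)] -/
theorem hasLocalPointsMaps_geomPointsEquiv_symm :
    HasLocalPointsMaps (C • W) W (geomPointsEquiv W C).symm.toAddMonoidHom := by
  intro E _ _
  refine ⟨(localPointsEquiv W C E).symm.toAddMonoidHom, fun τ Q ↦ ?_, fun Q ↦ ?_⟩
  · apply (localPointsEquiv W C E).injective
    change localPointsEquiv W C E ((localPointsEquiv W C E).symm (τ • Q)) =
      localPointsEquiv W C E (τ • (localPointsEquiv W C E).symm Q)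
    rw [AddEquiv.apply_symm_apply, localPointsEquiv_smul, AddEquiv.apply_symm_apply]
  · apply (localPointsEquiv W C E).injective
    change localPointsEquiv W C E ((localPointsEquiv W C E).symm (pointsMap (C • W) E Q)) =
      localPointsEquiv W C E (pointsMap W E ((geomPointsEquiv W C).symm Q))
    rw [AddEquiv.apply_symm_apply, ← pointsMap_geomPointsEquiv, AddEquiv.apply_symm_apply]

variable [NumberField K] [Fact p.Prime] (κ : ZpExtension K p)

/-- `Sel` of the substitution: `Sel_{p^∞}(W/K_∞) → Sel_{p^∞}(C • W/K_∞)` (§3 for `geomPointsEquiv`).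
[cite: SilvermanAEC2009, X.§4] -/
def selmerInftyMapOfSmul : W.selmerInfty κ →+ (C • W).selmerInfty κ :=
  selmerMap p κ.kerSubgroup (geomPointsEquiv W C).toAddMonoidHom (geomPointsEquiv_smul W C)
    (hasLocalPointsMaps_geomPointsEquiv W C)

/-- `Sel` of the inverse substitution: `Sel_{p^∞}(C • W/K_∞) → Sel_{p^∞}(W/K_∞)`. [cite: SilvermanAEC2009, X.§4] -/
def selmerInftyInvOfSmul : (C • W).selmerInfty κ →+ W.selmerInfty κ :=
  selmerMap p κ.kerSubgroup (geomPointsEquiv W C).symm.toAddMonoidHom (geomPointsEquiv_symm_smul W C)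
    (hasLocalPointsMaps_geomPointsEquiv_symm W C)

/-- The two maps are inverse to each other (composites `[1]`, §3). [cite: SilvermanAEC2009, X.§4 (Selmer group attached to E/K)] -/
theorem selmerInftyInvOfSmul_map (c : W.selmerInfty κ) :
    selmerInftyInvOfSmul W p C κ (selmerInftyMapOfSmul W p C κ c) = c := by
  have h := selmerMap_selmerMap_of_comp_eq_nsmul p κ.kerSubgroup
    (geomPointsEquiv W C).toAddMonoidHom (geomPointsEquiv_smul W C)
    (hasLocalPointsMaps_geomPointsEquiv W C) (geomPointsEquiv W C).symm.toAddMonoidHom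
    (geomPointsEquiv_symm_smul W C) (hasLocalPointsMaps_geomPointsEquiv_symm W C) (n := 1)
    (fun P ↦ by simp) c
  rw [one_smul] at h
  exact h

/-- The two maps are inverse to each other (composites `[1]`, §3). [cite: SilvermanAEC2009, X.§4 (Selmer group attached to E/K)] -/
theorem selmerInftyMapOfSmul_inv (c : (C • W).selmerInfty κ) :
    selmerInftyMapOfSmul W p C κ (selmerInftyInvOfSmul W p C κ c) = c := by
  have h := selmerMap_selmerMap_of_comp_eq_nsmul p κ.kerSubgroup
    (geomPointsEquiv W C).symm.toAddMonoidHom (geomPointsEquiv_symm_smul W C)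
    (hasLocalPointsMaps_geomPointsEquiv_symm W C) (geomPointsEquiv W C).toAddMonoidHom
    (geomPointsEquiv_smul W C) (hasLocalPointsMaps_geomPointsEquiv W C) (n := 1)
    (fun P ↦ by simp) c
  rw [one_smul] at h
  exact h

/-- **`Sel_{p^∞}(W/K_∞) ≃+ Sel_{p^∞}(C • W/K_∞)`**: the Selmer group over the `ℤ_p`-extension does not
depend on the Weierstrass model (Silverman, *AEC*, X.§4: the Selmer group is attached to `E/K`; here:
`Sel` of the substitution and of its inverse, §3, whose composites are `[1]`). [cite: SilvermanAEC2009, X.§4] -/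
def selmerInftyEquivOfSmul : W.selmerInfty κ ≃+ (C • W).selmerInfty κ where
  toFun := selmerInftyMapOfSmul W p C κ
  invFun := selmerInftyInvOfSmul W p C κ
  left_inv := selmerInftyInvOfSmul_map W p C κ
  right_inv := selmerInftyMapOfSmul_inv W p C κ
  map_add' := map_add _

/-- `selmerInftyMapOfSmul` commutes with the conjugation action `conj_γ` of `Γ_K` (so it is
`Λ`-linear for the `Λ`-structures `T = γ − 1`). [cite: SilvermanAEC2009, X.§4 (Selmer group attached to E/K)] -/
theorem coe_selmerInftyMapOfSmul_conjH1 (γ : absoluteGaloisGroup K) (c : W.selmerInfty κ)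
    (hγc : W.conjH1 p κ.kerSubgroup γ c ∈ W.selmerInfty κ) :
    (selmerInftyMapOfSmul W p C κ ⟨W.conjH1 p κ.kerSubgroup γ c, hγc⟩ :
        (C • W).subgroupH1 p κ.kerSubgroup) =
      (C • W).conjH1 p κ.kerSubgroup γ (selmerInftyMapOfSmul W p C κ c) :=
  coe_selmerMap_conjH1 p κ.kerSubgroup (geomPointsEquiv W C).toAddMonoidHom (geomPointsEquiv_smul W C)
    (hasLocalPointsMaps_geomPointsEquiv W C) γ c hγc

end VariableChange

/-! ## §6. Transport of the Iwasawa module `X(E/K_∞)` (`SelmerDualData`) along a change of variables -/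

section Transport

variable [NumberField K] [Fact p.Prime] (W) (C : VariableChange K) {κ : ZpExtension K p}
  {γ : absoluteGaloisGroup K}

/-- The characters of `X = Sel_{p^∞}(C • W/K_∞)^∨` read on `Sel_{p^∞}(W/K_∞)` (precomposition with
`selmerInftyMapOfSmul`). [cite: GreenbergLNM1716, §1 (Sel_E(F_∞)_p and its Pontryagin dual)] -/
def dualComap (D : (C • W).SelmerDualData κ γ) : D.X →+ (W.selmerInfty κ →+ AddCircle (1 : ℚ)) :=
  AddMonoidHom.mk' (fun x ↦ (D.toDual x).comp (selmerInftyMapOfSmul W p C κ))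
    (fun x y ↦ by rw [map_add, AddMonoidHom.add_comp])

/-- Values of `dualComap`. [cite: GreenbergLNM1716, §1 (Sel_E(F_∞)_p and its Pontryagin dual)] -/
@[simp] theorem dualComap_apply_apply (D : (C • W).SelmerDualData κ γ) (x : D.X) (s : W.selmerInfty κ) :
    dualComap W p C D x s = D.toDual x (selmerInftyMapOfSmul W p C κ s) :=
  rfl

/-- `dualComap` is injective (`selmerInftyMapOfSmul` is onto). [cite: GreenbergLNM1716, §1 (Sel_E(F_∞)_p and its Pontryagin dual)] -/
theorem dualComap_injective (D : (C • W).SelmerDualData κ γ) : Function.Injective (dualComap W p C D) := by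
  intro x y hxy
  apply D.bijective.1
  ext t
  have h := DFunLike.congr_fun hxy (selmerInftyInvOfSmul W p C κ t)
  rw [dualComap_apply_apply, dualComap_apply_apply, selmerInftyMapOfSmul_inv] at h
  exact h

/-- `dualComap` is surjective (`selmerInftyMapOfSmul` is injective with inverse `selmerInftyInvOfSmul`).
[cite: GreenbergLNM1716, §1 (Sel_E(F_∞)_p and its Pontryagin dual)] -/
theorem dualComap_surjective (D : (C • W).SelmerDualData κ γ) :
    Function.Surjective (dualComap W p C D) := by
  intro χ
  obtain ⟨x, hx⟩ := D.bijective.2 (χ.comp (selmerInftyInvOfSmul W p C κ))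
  refine ⟨x, ?_⟩
  ext s
  rw [dualComap_apply_apply, hx, AddMonoidHom.comp_apply, selmerInftyInvOfSmul_map]

/-- **The Iwasawa module of `C • W` is an Iwasawa module of `W`**: from a datum
`D : (C • W).SelmerDualData κ γ` (the `Λ`-module `X = Sel_{p^∞}(C • W/K_∞)^∨`) the datum on `W` with
THE SAME `Λ`-module `X`, its characters precomposed with `Sel_{p^∞}(W/K_∞) → Sel_{p^∞}(C • W/K_∞)`
(§5). Greenberg, LNM 1716, §1; Silverman, *AEC*, X.§4. [cite: GreenbergLNM1716, §1 (the Λ-module Sel_E(F_∞)_p attached to E/F)] -/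
def selmerDualDataOfSmul (D : (C • W).SelmerDualData κ γ) : W.SelmerDualData κ γ where
  X := D.X
  conj_mem := fun s hs ↦ W.map_conjH1_selmerGroupOver_le_holds p κ.kerSubgroup γ ⟨s, hs, rfl⟩
  toDual := dualComap W p C D
  bijective := ⟨dualComap_injective W p C D, dualComap_surjective W p C D⟩
  toDual_T_smul := fun x s ↦ by
    rw [dualComap_apply_apply, dualComap_apply_apply, dualComap_apply_apply,
      D.toDual_T_smul x (selmerInftyMapOfSmul W p C κ s)]
    congr 2
    exact Subtype.ext (coe_selmerInftyMapOfSmul_conjH1 W p C κ γ s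
      (W.map_conjH1_selmerGroupOver_le_holds p κ.kerSubgroup γ ⟨s, s.2, rfl⟩)).symm
  toDual_C_smul := fun c x s k hk ↦ by
    rw [dualComap_apply_apply, dualComap_apply_apply]
    exact D.toDual_C_smul c x _ k (by rw [← map_nsmul, hk, map_zero])

/-- The transported datum has the same underlying `Λ`-module. [cite: GreenbergLNM1716, §1 (Sel_E(F_∞)_p and its Pontryagin dual)] -/
theorem selmerDualDataOfSmul_X (D : (C • W).SelmerDualData κ γ) : (selmerDualDataOfSmul W p C D).X = D.X :=
  rfl

/-- **The characteristic ideal of `X(E/K_∞)` does not depend on the Weierstrass model**: the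
transported datum has the same characteristic ideal (same module). Greenberg, LNM 1716, §1.
[cite: GreenbergLNM1716, §1 (char ideal of X attached to E/F)] -/
theorem charIdeal_selmerDualDataOfSmul (D : (C • W).SelmerDualData κ γ) :
    (selmerDualDataOfSmul W p C D).charIdeal = D.charIdeal :=
  rfl

/-- Torsion-ness is likewise unchanged (same module). [cite: GreenbergLNM1716, §1] -/
theorem isTorsion_selmerDualDataOfSmul_iff (D : (C • W).SelmerDualData κ γ) :
    (selmerDualDataOfSmul W p C D).IsTorsion ↔ D.IsTorsion :=
  Iff.rfl

/-- `μ` is unchanged. [cite: GreenbergLNM1716, §1] -/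
theorem mu_selmerDualDataOfSmul (D : (C • W).SelmerDualData κ γ) :
    (selmerDualDataOfSmul W p C D).mu = D.mu :=
  rfl

/-- `λ` is unchanged. [cite: GreenbergLNM1716, §1] -/
theorem lambda_selmerDualDataOfSmul (D : (C • W).SelmerDualData κ γ) :
    (selmerDualDataOfSmul W p C D).lambda = D.lambda :=
  rfl

/-- **`∃`-form along an equation of models** (the tree's spelling "`W₂` is a `K`-model of `W₁`",
`C • W₁ = W₂`, e.g. `∃ C, C • W' = W.quadraticTwist d`): every Iwasawa-module datum on `W₂` has a
companion datum on `W₁` with the same characteristic ideal and the same torsion-ness. Use: a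
main-conjecture statement proved for the (minimal) model `W₁` transfers to the datum of `W₂`.
[cite: GreenbergLNM1716, §1] [cite: SilvermanAEC2009, X.§4] -/
theorem exists_selmerDualData_of_smul_eq {W₁ W₂ : WeierstrassCurve K} {C : VariableChange K}
    (h : C • W₁ = W₂) (D₂ : W₂.SelmerDualData κ γ) :
    ∃ D₁ : W₁.SelmerDualData κ γ, D₁.charIdeal = D₂.charIdeal ∧ (D₁.IsTorsion ↔ D₂.IsTorsion) := by
  subst h
  exact ⟨selmerDualDataOfSmul W₁ p C D₂, rfl, Iff.rfl⟩

end Transport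

end Literature.NumberTheory.EllipticCurves.IsogenySelmerInfty

end
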